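import Summits.ResolutionOfSingularities.ResolutionOfSingularities.Theorems.RadicialJungCleanModelsCleanLU3CompositeFormOneLift
import Literature.AlgebraicGeometry.Resolution.ValuationOverrings
import HarnessLib

/-!
# Route `RadicialJung`, crux `CleanModels` (stmt-15917) — (C-curve) sub-line: point blow-ups at a point of the centre curve (weak form of `stub_Cc_pointPrep`)

Lead `res-B-lead-1` g6 (plan `Cruxes/CleanModels/Lines/Sketch-memo-Ccurve-plan.md` §1 S5₀; workfile `Lines/Sketch_Ccurve_assembly.lean` v2.4).  OURS · counted 0.
Nothing here proves resolution in characteristic `p`; resolution in char `p` is NOT proved.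

`pointPrep_weak`: given a model `B'` regular of dimension `3` at the centre of `O` with r.s.p. `(x, y, z)` such that the centre of the coarsening `O₁ ≥ O` is
`V(x, y)` (`v₁ w < 1 ↔ w ∈ (x, y)`), `n` point blow-ups produce a model `B''` regular of dimension `3` at the centre of `O` with r.s.p. `(x / z^n, y / z^n, z)` and
`O_{B',P} ≤ O_{B'',P''}`.  This is the part of the registered stub `stub_Cc_pointPrep` that the persistence step `stub_Cc_persistForm2` consumes (it does NOT
assert `B' ≤ B''`, the equality of the local rings at the centre of `O₁`, or the new centre characterisation).  Proof: twice ✓ `exists_model_rsop_div_pow`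
(`(t, t₂, t₃) := (x, z, y)`, then `(y, z, x / z^n)`), the depth hypothesis `v x < v z^(m+1)` holding because `v₁ x < 1 = v₁ z` descends along `O ≤ O₁`.
-/

noncomputable section

set_option linter.dupNamespace false

open IsLocalRing Literature.AlgebraicGeometry.Resolution
open Summit.ResolutionOfSingularities.ResolutionOfSingularities.Theorems

namespace Summit.ResolutionOfSingularities.ResolutionOfSingularities.Theorems.RadicialJung.CleanModels.Ccurve

/-- In a regular local ring of embedding dimension `3` with `𝔪 = (x, y, z)`, the parameter `z` is not in `(x, y)`. [folklore] -/
theorem not_mem_span_pair_of_rsp {S : Type} [CommRing S] [IsRegularLocalRing S] (hd : (maximalIdeal S).spanFinrank = 3) (x y z : S)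
    (hxyz : maximalIdeal S = Ideal.span {x, y, z}) : z ∉ Ideal.span ({x, y} : Set S) := by
  classical
  have hrange : Ideal.span (Set.range ![x, y, z]) = maximalIdeal S := by
    rw [hxyz]; congr 1; ext v; simp only [Set.mem_range, Set.mem_insert_iff, Set.mem_singleton_iff]
    constructor
    · rintro ⟨j, rfl⟩; fin_cases j <;> simp
    · rintro (rfl | rfl | rfl); exacts [⟨0, rfl⟩, ⟨1, rfl⟩, ⟨2, rfl⟩]
  have h3 := not_mem_span_image_of_not_mem hd ![x, y, z] hrange (S := (({0, 1} : Finset (Fin 3)) : Set (Fin 3))) (i := 2) (by decide)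
  intro hz
  apply h3
  have himg : (![x, y, z] '' ((({0, 1} : Finset (Fin 3)) : Set (Fin 3)))) = {x, y} := by
    ext v
    simp only [Finset.coe_insert, Finset.coe_singleton, Set.image_insert_eq, Set.image_singleton, Set.mem_insert_iff,
      Set.mem_singleton_iff, Matrix.cons_val_zero, Matrix.cons_val_one]
  rw [himg]; exact hz

/-- **Weak point preparation (the part of `stub_Cc_pointPrep` used by `stub_Cc_persistForm2`).**  `n` point blow-ups at the closed point of a model regular of
dimension `3` at the centre of `O`, with r.s.p. `(x, y, z)` and `V(x, y)` the centre of the coarsening `O₁`, yield a model regular of dimension `3` at the centre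
of `O` with r.s.p. `(x / z^n, y / z^n, z)`, dominating the old local ring. -/
theorem pointPrep_weak :
    ∀ (k : Type) [Field k] (K : Type) [Field K] [Algebra k K]
    (O : ValuationSubring K) (A : Subalgebra k K), A.toSubring ≤ O.toSubring → A.FG → IsFractionRing A K → ringKrullDim A ≤ 3 →
    (∀ (T : Subring K) (hT : T ≤ O.toSubring), A.toSubring ≤ T → (subringCentre T O hT).IsMaximal) →
    ∀ (B' : Subalgebra k K) (hB'O : B'.toSubring ≤ O.toSubring), A ≤ B' → B'.FG →
    IsRegularLocalRing (locAtCentre B'.toSubring O) → ringKrullDim (locAtCentre B'.toSubring O) = 3 →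
    ∀ (O₁ : ValuationSubring K), O ≤ O₁ →
    ∀ (x y z : K) (hx : x ∈ locAtCentre B'.toSubring O) (hy : y ∈ locAtCentre B'.toSubring O) (hz : z ∈ locAtCentre B'.toSubring O),
      (haveI := isLocalRing_locAtCentre hB'O; IsLocalRing.maximalIdeal (locAtCentre B'.toSubring O)) =
        Ideal.span {⟨x, hx⟩, ⟨y, hy⟩, ⟨z, hz⟩} →
      (∀ w : ↥(locAtCentre B'.toSubring O), O₁.valuation (w : K) < 1 ↔ w ∈ Ideal.span {(⟨x, hx⟩ : ↥(locAtCentre B'.toSubring O)), ⟨y, hy⟩}) →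
    ∀ n : ℕ,
    ∃ (B'' : Subalgebra k K) (hB''O : B''.toSubring ≤ O.toSubring), A ≤ B'' ∧ B''.FG ∧
    IsRegularLocalRing (locAtCentre B''.toSubring O) ∧ ringKrullDim (locAtCentre B''.toSubring O) = 3 ∧
    locAtCentre B'.toSubring O ≤ locAtCentre B''.toSubring O ∧
    ∃ (h₁ : x / z ^ n ∈ locAtCentre B''.toSubring O) (h₂ : y / z ^ n ∈ locAtCentre B''.toSubring O) (h₃ : z ∈ locAtCentre B''.toSubring O),
      (haveI := isLocalRing_locAtCentre hB''O; IsLocalRing.maximalIdeal (locAtCentre B''.toSubring O)) =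
        Ideal.span {⟨_, h₁⟩, ⟨_, h₂⟩, ⟨_, h₃⟩} := by
  intro k _ K _ _ O A hAO hAfg hfrac hdimA hzd B' hB'O hAB' hB'fg hB'reg hB'dim O₁ hOO₁ x y z hx hy hz hmax hcen n
  classical
  haveI := hfrac
  haveI := isLocalRing_locAtCentre hB'O
  -- `dim A = 3`
  have hdimA3 : ringKrullDim A = 3 := by
    rw [← ringKrullDim_eq_of_fg_of_le hAfg hB'fg hAB', ← ringKrullDim_locAtCentre_eq_of_isMaximal B' hB'fg O hB'O (hzd _ hB'O fun w hw => hAB' hw)]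
    exact hB'dim
  -- `v₁ z = 1`, `v₁ x < 1`, `v₁ y < 1`
  have hd : (maximalIdeal ↥(locAtCentre B'.toSubring O)).spanFinrank = 3 := spanFinrank_eq_three_of_dim _ hB'dim
  have hzns : (⟨z, hz⟩ : ↥(locAtCentre B'.toSubring O)) ∉ Ideal.span ({⟨x, hx⟩, ⟨y, hy⟩} : Set _) :=
    not_mem_span_pair_of_rsp hd _ _ _ hmax
  have hvz : O₁.valuation z = 1 := by
    have h1 : ¬ O₁.valuation z < 1 := fun h => hzns ((hcen ⟨z, hz⟩).mp h)
    exact le_antisymm ((O₁.valuation_le_one_iff _).mpr (hOO₁ (locAtCentre_le hB'O hz))) (not_lt.mp h1)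
  have hvx : O₁.valuation x < 1 := (hcen ⟨x, hx⟩).mpr (Ideal.subset_span (by simp))
  have hvy : O₁.valuation y < 1 := (hcen ⟨y, hy⟩).mpr (Ideal.subset_span (by simp))
  have hdeep : ∀ w : K, O₁.valuation w < 1 → ∀ m : ℕ, O.valuation w < O.valuation (z ^ (m + 1)) := fun w hw m =>
    valuation_lt_of_lt_of_le hOO₁ (by rw [map_pow, hvz, one_pow]; exact hw)
  -- first run: `(t, t₂, t₃) := (x, z, y)`
  have hmax₁ : maximalIdeal ↥(locAtCentre B'.toSubring O) = Ideal.span {⟨x, hx⟩, ⟨z, hz⟩, ⟨y, hy⟩} := by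
    rw [hmax]; congr 1; ext v; simp only [Set.mem_insert_iff, Set.mem_singleton_iff]; tauto
  obtain ⟨A₂, hAA₂, hA₂fg, hA₂O, hreg₂, h12, h₁, h₂, h₃, hmax₂⟩ :=
    exists_model_rsop_div_pow O A hAfg hzd hdimA3 n B' hAB' hB'fg hB'O hB'reg x z y hx hz hy hmax₁ (hdeep x hvx)
  -- second run: `(t, t₂, t₃) := (y, z, x / z ^ n)`
  haveI := isLocalRing_locAtCentre hA₂O
  have hmax₂' : maximalIdeal ↥(locAtCentre A₂.toSubring O) = Ideal.span {⟨y, h₃⟩, ⟨z, h₂⟩, ⟨x / z ^ n, h₁⟩} := by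
    rw [hmax₂]; congr 1; ext v; simp only [Set.mem_insert_iff, Set.mem_singleton_iff]; tauto
  obtain ⟨A₃, hAA₃, hA₃fg, hA₃O, hreg₃, h23, g₁, g₂, g₃, hmax₃⟩ :=
    exists_model_rsop_div_pow O A hAfg hzd hdimA3 n A₂ hAA₂ hA₂fg hA₂O hreg₂ y z (x / z ^ n) h₃ h₂ h₁ hmax₂' (hdeep y hvy)
  haveI := isLocalRing_locAtCentre hA₃O
  have hdim₃ : ringKrullDim ↥(locAtCentre A₃.toSubring O) = 3 := by
    rw [ringKrullDim_locAtCentre_eq_of_isMaximal A₃ hA₃fg O hA₃O (hzd _ hA₃O fun w hw => hAA₃ hw), ringKrullDim_eq_of_fg_of_le hAfg hA₃fg hAA₃, hdimA3]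
  refine ⟨A₃, hA₃O, hAA₃, hA₃fg, hreg₃, hdim₃, h12.trans h23, g₃, g₁, g₂, ?_⟩
  rw [hmax₃]; congr 1; ext v; simp only [Set.mem_insert_iff, Set.mem_singleton_iff]; tauto

end Summit.ResolutionOfSingularities.ResolutionOfSingularities.Theorems.RadicialJung.CleanModels.Ccurve

end
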